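import Literature.IUT.HodgeTheaters.PMBaseBridgePropsProofs3
import Literature.IUT.HodgeTheaters.PMBaseBridgePropsProofs4

/-!
# Proofs over [IUTchI] Prop 6.6 (iv): the `{±1}^𝕍`-family of gluing data over a fixed index bijection

Mochizuki, *Inter-universal Teichmüller theory I*, §6, Proposition 6.6 (iv) p. 166, kurims manuscript
(May 2020): over a fixed isomorphism of `𝔽_l^±`-torsors between the index sets, the capsule-`+`-full
poly-isomorphisms that glue a `𝒟-Θ^±`-bridge to a `𝒟-Θ^{ell}`-bridge form a torsor under "the subgroup
`{±1} × ({±1}^𝕍)`" — here, the `{±1}^𝕍`-part (Example 6.2 (iii)). PROOF-ONLY companion (theorems, no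
definitions) to abc-iut-L5-t4's `PMBaseBridgeProps.lean`, by the L5 discharge seat abc-iut-L5-t13.

PROVED here (the existence direction of the third conjunct of the named statement `GluingTorsor`):
twisting the model coordinates of the `Θ^±`-side by ANY automorphism `s` of the tautological
`𝒟`-prime-strip yields again a gluing datum that glues, over the same index bijection
(`GluingData.exists_of_coords_twist`); two twists give the same datum iff `s`, `s'` have the same sign
vector, so over every isomorphism of `𝔽_l^±`-torsors there are (at least) `{±1}^𝕍`-many gluing data that
glue, realised injectively by sign vectors (`GluingData.twist_injective`). The converse (every gluing
datum over the index bijection is such a twist — rigidity) is the remaining half.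
Record only; [claim: Mochizuki2012, status: disputed]; nothing here takes a side on any disputed step.
-/

namespace Literature.IUT.HodgeTheaters

open CategoryTheory

universe u

namespace PMBaseKit

variable {l : ℕ} {K : PMBaseKit.{u} l}

/-- Two twists give the same constituent poly-isomorphisms iff the twisting automorphisms have the same
sign vector: the twisted gluing data over a fixed index bijection are parametrised INJECTIVELY by
`{±1}^𝕍` ([IUTchI] Prop 6.6 (iv) p. 166, "the subgroup `{±1} × ({±1}^𝕍)`").
[claim: Mochizuki2012, status: disputed] -/
theorem GluingData.twist_injective {C₁ C₂ : K.DStrip} (a : (DStrip.model K).Iso C₁)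
    (a' : (DStrip.model K).Iso C₂) {s s' : (DStrip.model K).Iso (DStrip.model K)} {α α' : K.V → ℤˣ}
    (hs : s ∈ (DStrip.model K).signedPolyAut α) (hs' : s' ∈ (DStrip.model K).signedPolyAut α')
    (h : DStrip.plusFullPolyIso ((a.symm.trans s).trans a') = DStrip.plusFullPolyIso ((a.symm.trans s').trans a')) :
    α = α' := by
  rw [DStrip.plusFullPolyIso_eq_iff] at h
  rw [DStrip.mem_signedPolyAut_iff] at hs hs'
  funext v
  have hv := h v
  change K.labMap v (((a v).symm ≪≫ s v) ≪≫ a' v) = K.labMap v (((a v).symm ≪≫ s' v) ≪≫ a' v) at hv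
  rw [K.labMap_trans, K.labMap_trans, K.labMap_trans, K.labMap_trans] at hv
  have hss' : K.labMap v (s v) = K.labMap v (s' v) := by
    ext x
    have := congrArg (fun e => (K.labMap v (a' v)).symm (e ((K.labMap v (a v)) x))) hv
    simpa [labMap_symm] using this
  rcases Int.units_eq_one_or (α v) with h1 | h1 <;> rcases Int.units_eq_one_or (α' v) with h2 | h2 <;>
    rw [h1, h2]
  · exact absurd ((hs v).mpr h1) (by rw [hss']; intro hh; exact absurd ((hs' v).mp hh) (by rw [h2]; decide))
  · exact absurd ((hs' v).mpr h2) (by rw [← hss']; intro hh; exact absurd ((hs v).mp hh) (by rw [h1]; decide))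

/-- **Twisted gluing data — an injective `{±1}^𝕍`-family.** As `GluingData.exists_of_coords`, with the
coordinates of the `Θ^±`-side twisted by an automorphism `s_σ` of the tautological `𝒟`-prime-strip of
sign vector `σ ∈ {±1}^𝕍`: the capsule-`+`-full poly-isomorphism through `α'_{z+c} ∘ s_σ ∘ α_z⁻¹` glues,
with coordinates `(ι, s_σ⁻¹α, s_σ⁻¹β, b ∘ γ)`, and `σ ↦` (this datum) is injective ([IUTchI] Prop 6.6 (iv)
p. 166; Example 6.2 (iii) p. 160). [claim: Mochizuki2012, status: disputed] -/
theorem GluingData.exists_injective_family_of_coords (B : K.DThetaPMBridge) (B' : K.DThetaEllBridge)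
    {ι : ZMod l ≃ B.T} (hι : ∀ e ∈ B.grpT.charts, ι.trans e ∈ (FlPMGroup.tautological l).charts)
    {α : ∀ z, (DStrip.model K).Iso (B.capsule (ι z))} {β : (DStrip.model K).Iso B.codomain}
    (hB : ∀ z, B.poly (ι z) = DStrip.polyConj (α z) β (Ex62.poly K z))
    {ι' : ZMod l ≃ B'.T} (hι' : ∀ e ∈ B'.torT.charts, ι'.trans e ∈ (FlPMTorsor.tautological l).charts)
    {α' : ∀ z, (DStrip.model K).Iso (B'.capsule (ι' z))} {γ : K.gModel ≅ B'.glob}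
    (hB' : ∀ z v, B'.poly (ι' z) v = K.ellConj (α' z) γ v (Ex63.poly K z v)) (c : ZMod l) :
    ∃ Φ : (K.V → ℤˣ) →
        {G : GluingData B B' // G.Glues ∧ G.indexEquiv = ι.symm.trans ((Equiv.addRight c).trans ι')},
      Function.Injective Φ := by
  obtain ⟨b, hb⟩ := Ex63.lifts_nonempty (K := K) (FlPM.transl c)
  let αT : ∀ t : B.T, (DStrip.model K).Iso (B.capsule t) := fun t v =>
    α (ι.symm t) v ≪≫ eqToIso (congrArg (fun s => (B.capsule s).obj v) (ι.apply_symm_apply t))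
  have hαT : ∀ z, αT (ι z) = α z := fun z =>
    DStrip.isoCast_eq (fun s => B.capsule (ι s)) _ α (ι.symm_apply_apply z)
  have hex : ∀ σ : K.V → ℤˣ, ∃ s : (DStrip.model K).Iso (DStrip.model K),
      s ∈ (DStrip.model K).signedPolyAut σ := DStrip.exists_mem_signedPolyAut _
  choose s hs using hex
  -- the family
  let mk : (DStrip.model K).Iso (DStrip.model K) → GluingData B B' := fun s₀ =>
    { indexEquiv := ι.symm.trans ((Equiv.addRight c).trans ι')
      poly := fun t => DStrip.plusFullPolyIso (((αT t).symm.trans s₀).trans (α' (ι.symm t + c)))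
      poly_plusFull := fun t => ⟨_, rfl⟩ }
  have hglues : ∀ s₀, (mk s₀).Glues := by
    intro s₀
    refine ⟨?_, ι, hι, fun z => s₀.symm.trans (α z), s₀.symm.trans β, b ≪≫ γ, fun z => ?_, fun z v => ?_⟩
    · intro e he
      change ι.symm.trans (((Equiv.addRight c).trans ι').trans e) ∈ B.grpT.toTorsor.charts
      rw [Equiv.trans_assoc]
      exact B.grpT.toTorsor.symm_trans_mem_of_compat (DThetaPMEllHT.indexEquiv_torsor_charts B.grpT ι hι)
        (FlPMTorsor.addRight_trans_mem_tautological c (hι' e he))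
    · rw [hB z, Ex62.poly_eq, DStrip.polyConj_plusFullPolyIso, DStrip.polyConj_plusFullPolyIso]
      congr 1
      funext v
      change ((α z v).symm ≪≫ CategoryTheory.Iso.refl _) ≪≫ β v =
        (((s₀ v).symm ≪≫ α z v).symm ≪≫ CategoryTheory.Iso.refl _) ≪≫ ((s₀ v).symm ≪≫ β v)
      simp
    · change {h | ∃ p ∈ DStrip.plusFullPolyIso (((αT (ι z)).symm.trans s₀).trans (α' (ι.symm (ι z) + c))),
          ∃ g ∈ B'.poly (ι' (ι.symm (ι z) + c)) v, h = (p v).hom ≫ g} = _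
      have hs' : ((αT (ι z)).symm.trans s₀).trans (α' (ι.symm (ι z) + c)) =
          (s₀.symm.trans (α z)).symm.trans (α' (ι.symm (ι z) + c)) := by
        rw [hαT]
        rfl
      rw [hs', hB', ellConj_capsule_side, Equiv.symm_apply_apply, ellConj_poly_add _ γ z c v hb]
  refine ⟨fun σ => ⟨mk (s σ), hglues (s σ), rfl⟩, fun σ σ' hσ => ?_⟩
  have hmk : mk (s σ) = mk (s σ') := congrArg Subtype.val hσ
  have hpoly : (mk (s σ)).poly = (mk (s σ')).poly := by
    simp only [mk, GluingData.mk.injEq] at hmk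
    exact eq_of_heq hmk.2
  have h0 := congrFun hpoly (ι 0)
  change DStrip.plusFullPolyIso (((αT (ι 0)).symm.trans (s σ)).trans (α' (ι.symm (ι 0) + c))) =
    DStrip.plusFullPolyIso (((αT (ι 0)).symm.trans (s σ')).trans (α' (ι.symm (ι 0) + c))) at h0
  exact GluingData.twist_injective _ _ (hs σ) (hs σ') h0

/-- **[IUTchI] Prop 6.6 (iv), third clause, existence direction — PROVED**: over every isomorphism of
`𝔽_l^±`-torsors `κ : T ⥲ T'` between the index sets there is an INJECTIVE family, indexed by `{±1}^𝕍`, of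
gluing data that glue with index bijection `κ` (the `{±1}^𝕍`-orbit of Example 6.2 (iii) acting on gluing
data). [claim: Mochizuki2012, status: disputed] -/
theorem GluingData.exists_injective_family (B : K.DThetaPMBridge) (B' : K.DThetaEllBridge)
    (κ : B.T ≃ B'.T) (hκ : B.grpT.toTorsor.Compat B'.torT κ) :
    ∃ Φ : (K.V → ℤˣ) → {G : GluingData B B' // G.Glues ∧ G.indexEquiv = κ}, Function.Injective Φ := by
  -- reduce to `κ` of coordinate form, as in `exists_glues_of_compat`
  obtain ⟨ι, hι, α, β, hB⟩ := B.exists_model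
  obtain ⟨ι', hι', α', γ, hB'⟩ := B'.exists_model
  have hκ₀ : ι.trans (κ.trans ι'.symm) ∈ (FlPMTorsor.tautological l).charts := by
    have h := DThetaPMEllHT.indexEquiv_torsor_charts B.grpT ι hι _
      (hκ _ (B'.torT.symm_trans_mem_of_compat hι' (e₀ := Equiv.refl _) ⟨1, by
        show FlPM.toPerm l 1 = _; rw [map_one]; rfl⟩))
    simpa only [Equiv.trans_refl] using h
  obtain ⟨g₀, hg₀⟩ := hκ₀
  have hκeq : κ = ι.symm.trans ((FlPM.toPerm l g₀).trans ι') := by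
    ext t
    have ht := congrArg (fun f : ZMod l ≃ ZMod l => ι' (f (ι.symm t))) hg₀
    simpa using ht.symm
  -- a uniform statement over coordinates of the `Θ^±`-side
  have main : ∀ {ι₀ : ZMod l ≃ B.T} (hι₀ : ∀ e ∈ B.grpT.charts, ι₀.trans e ∈ (FlPMGroup.tautological l).charts)
      {α₀ : ∀ z, (DStrip.model K).Iso (B.capsule (ι₀ z))}
      (hB₀ : ∀ z, B.poly (ι₀ z) = DStrip.polyConj (α₀ z) β (Ex62.poly K z)) (c : ZMod l),
      κ = ι₀.symm.trans ((Equiv.addRight c).trans ι') →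
      ∃ Φ : (K.V → ℤˣ) → {G : GluingData B B' // G.Glues ∧ G.indexEquiv = κ}, Function.Injective Φ := by
    intro ι₀ hι₀ α₀ hB₀ c hκc
    subst hκc
    exact GluingData.exists_injective_family_of_coords B B' hι₀ hB₀ hι' hB' c
  rcases FlPM.isPositive_or_isNegative g₀ with hpos | hneg
  · obtain ⟨c, rfl⟩ := (FlPM.isPositive_iff_exists_transl g₀).mp hpos
    rw [FlPM.toPerm_transl] at hκeq
    exact main hι hB c hκeq
  · have hκeq' : κ = ((Equiv.neg (ZMod l)).trans ι).symm.trans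
        ((Equiv.addRight g₀.left.toAdd).trans ι') := by
      rw [hκeq, FlPM.toPerm_of_isNegative hneg]
      ext t
      rfl
    exact main (ι₀ := (Equiv.neg (ZMod l)).trans ι) (B.grpT.neg_trans_compat hι)
      (α₀ := fun z => α (-z)) (fun z => by rw [← Ex62.poly_neg K z]; exact hB (-z)) _ hκeq'

end PMBaseKit

end Literature.IUT.HodgeTheaters
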